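import Mathlib.Analysis.PSeries
import Mathlib.LinearAlgebra.LinearIndependent.Basic
import Mathlib.Algebra.Algebra.Rat
import HarnessLib

/-!
# Okada's theorem (Hurwitz-zeta form): the free half of the Chowla–Milnor conjecture

Write `ζ(k, x) = Σ_{n ≥ 0} (n + x)^{-k}` (`0 < x ≤ 1`, `k ≥ 2`) for the Hurwitz zeta values. The
**Chowla–Milnor conjecture** [GunRammurtyRath2011, p. 1329] asserts that for `k ≥ 2`, `q ≥ 3` the
`φ(q)` real numbers `ζ(k, a/q)`, `(a, q) = 1`, `1 ≤ a ≤ q`, are linearly independent over `ℚ`; it is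
open (and, being a conjecture, is NOT vendored here). Its "free half" is a theorem.
**Okada's theorem** [Okada1981] (extending a theorem of S. Chowla on the values `cot(πa/p)`, `p`
prime, to all derivatives of `cot` and composite moduli), as restated in
[GunRammurtyRath2011, Lemma 1, p. 1332]:

> Let `k ≥ 1` and `q ≥ 3` be integers and let `T` be a set of `φ(q)/2` residues mod `q` such that
> `T ∪ (−T)` is a complete set of coprime residue classes mod `q`. Then the real numbers
> `(d/dz)^{k−1} cot(πz)|_{z = a/q}`, `a ∈ T`, are linearly independent over `ℚ`.

For `k ≥ 2` and the half-system `T = {a : 1 ≤ a < q/2, (a, q) = 1}`, the classical identity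
`ζ(k, a/q) + (−1)^k ζ(k, 1 − a/q) = ((−1)^{k−1}/(k−1)!) · D^{k−1}(π cot πz)|_{z = a/q}`
[GunRammurtyRath2011, eq. (2)] exhibits the numbers `ζ(k, a/q) + (−1)^k ζ(k, 1 − a/q)`, `a ∈ T`,
as the common non-zero multiple `(−1)^{k−1} π^k/(k−1)!` of Okada's numbers, so they are
`ℚ`-linearly independent as well; this is the proof of [GunRammurtyRath2011, Thm. 1]
(`dim_ℚ V_k(q) ≥ φ(q)/2` for the Chowla–Milnor space `V_k(q) = span_ℚ {ζ(k, a/q) : (a, q) = 1}`)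
printed on p. 1332 there.

* `okada_linearIndependent_hurwitzZeta` — the NAMED FACT (D-0014): for `k ≥ 2`, `q ≥ 3` the family
  `a ↦ ζ(k, a/q) + (−1)^k ζ(k, 1 − a/q)` on `{a : ℕ // 2a < q ∧ (a, q) = 1}` is
  `LinearIndependent ℚ`
  (Hurwitz values written as the real series `Σ' n : ℕ, 1/(n + x)^k`, as on p. 1328 of the source).
* PROVED consequences (elementary rescalings, for the users' vocabularies):
  `okada_linearIndependent_hurwitzZeta.level_scaled` — the same for the level-`q` lattice sums
  `Σ_{n ≥ 0} (qn + a)^{-k} + (−1)^k Σ_{n ≥ 0} (qn + (q − a))^{-k}`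
  (`= q^{-k}(ζ(k, a/q) + (−1)^k ζ(k, 1 − a/q))`, the shape of the Hurwitz box integrals of
  `BoxIntegralHurwitz.lean`);
  `okada_linearIndependent_hurwitzZeta.int_tsum` — the same for the two-sided sums
  `Σ_{n ∈ ℤ} (n + a/q)^{-k}` (`tsum_int_one_div_add_pow`:
  `Σ_{n ∈ ℤ} (n + x)^{-k} = ζ(k, x) + (−1)^k ζ(k, 1 − x)`).

Deliberately NOT here: the case `k = 1` and general half-systems `T` of Okada's printed statement
(TODO(general form): the values `cot^{(k−1)}(πa/q)` themselves; Mathlib has the partial-fraction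
series of `D^k(π cot πz)` on the upper half-plane only,
`iteratedDerivWithin_cot_pi_mul_eq_mul_tsum_div_pow`, not at real points); the companion
algebraicity `Z_k(a, q) = (ζ(k, a/q) − ζ(k, 1 − a/q))/(2πi)^k ∈ ℚ(ζ_q)` for odd `k`
[GunRammurtyRath2011, Prop. 1 and its proof, p. 1333]; the Chowla–Milnor conjecture and its
consequences (Thms. 2–4 there).

## References

* [Okada1981] T. Okada, *On an extension of a theorem of S. Chowla*, Acta Arith. 38 (1980/81),
  341–345, doi:10.4064/aa-38-4-341-345 (the Theorem).
* [GunRammurtyRath2011] S. Gun, M. R. Murty, P. Rath, *On a conjecture of Chowla and Milnor*,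
  Canad. J. Math. 63 (2011), 1328–1344, doi:10.4153/CJM-2011-034-2 (Lemma 1, eq. (2), Thm. 1,
  pp. 1330–1332).
-/

noncomputable section

open scoped BigOperators

namespace Literature.NumberTheory.Transcendental

/-- **Okada's theorem, in the Hurwitz-zeta form in which Gun–Murty–Rath apply it** (whence their
bound `dim_ℚ V_k(q) ≥ φ(q)/2` for the Chowla–Milnor space `V_k(q)`).
Write `ζ(k, x) = Σ_{n ≥ 0} (n + x)^{-k}`. For all integers `k ≥ 2` and `q ≥ 3`, the `φ(q)/2` real
numbers
`ζ(k, a/q) + (−1)^k ζ(k, 1 − a/q)`, `1 ≤ a < q/2`, `(a, q) = 1`,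
are linearly independent over `ℚ`.

This is Okada's theorem [Okada1981] = [GunRammurtyRath2011, Lemma 1] (for `k ≥ 1`, `q ≥ 3` and a
half-system `T` of coprime residues mod `q`, the numbers `(d/dz)^{k−1} cot(πz)|_{z=a/q}`, `a ∈ T`,
are `ℚ`-linearly independent) for `k ≥ 2` and `T = {1 ≤ a < q/2, (a, q) = 1}`, transported along
`ζ(k, a/q) + (−1)^k ζ(k, 1 − a/q) = ((−1)^{k−1}/(k−1)!)·D^{k−1}(π cot πz)|_{z=a/q}`
[GunRammurtyRath2011, eq. (2)] (a common non-zero factor `(−1)^{k−1}π^k/(k−1)!`), exactly as in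
the proof of [GunRammurtyRath2011, Thm. 1] on p. 1332. The index type
`{a : ℕ // 2 * a < q ∧ Nat.Coprime a q}` is the half-system `1 ≤ a < q/2, (a, q) = 1`
(`a = 0` is excluded since `Nat.Coprime 0 q ↔ q = 1`), so every `a/q` and `1 − a/q` lies in `(0, 1)`
and all the series converge (`k ≥ 2`).
[cite: GunRammurtyRath2011, Lemma 1 and eq. (2) (proof of Thm. 1), p. 1332]
[cite: Okada1981, Theorem] -/
def okada_linearIndependent_hurwitzZeta : Prop :=
  ∀ (k q : ℕ), 2 ≤ k → 3 ≤ q →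
    LinearIndependent ℚ fun a : {a : ℕ // 2 * a < q ∧ Nat.Coprime a q} =>
      (∑' n : ℕ, 1 / ((n : ℝ) + (a : ℕ) / (q : ℝ)) ^ k) +
        (-1 : ℝ) ^ k * ∑' n : ℕ, 1 / ((n : ℝ) + (1 - (a : ℕ) / (q : ℝ))) ^ k

/-! ### Elementary rescalings (proved) -/

/-- The summand rescaling `1/(n + b/q)^k = q^k · 1/(qn + b)^k` (`q ≠ 0`). [folklore] -/
theorem one_div_natCast_add_div_pow (n k : ℕ) {q : ℝ} (hq : q ≠ 0) (b : ℝ) :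
    1 / ((n : ℝ) + b / q) ^ k = q ^ k * (1 / (q * n + b) ^ k) := by
  have h : (n : ℝ) + b / q = (q * n + b) / q := by field_simp
  rw [h, div_pow, one_div_div, mul_one_div]

/-- The reflected summand rescaling `1/(n + (1 − b/q))^k = q^k · 1/(qn + (q − b))^k` (`q ≠ 0`).
[folklore] -/
theorem one_div_natCast_add_one_sub_div_pow (n k : ℕ) {q : ℝ} (hq : q ≠ 0) (b : ℝ) :
    1 / ((n : ℝ) + (1 - b / q)) ^ k = q ^ k * (1 / (q * n + (q - b)) ^ k) := by
  have h : (n : ℝ) + (1 - b / q) = (q * n + (q - b)) / q := by field_simp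
  rw [h, div_pow, one_div_div, mul_one_div]

/-- **Level-scaled form** (PROVED from the fact). For `k ≥ 2`, `q ≥ 3` the real numbers
`Σ_{n ≥ 0} 1/(qn + a)^k + (−1)^k Σ_{n ≥ 0} 1/(qn + (q − a))^k`
(`= q^{-k}(ζ(k, a/q) + (−1)^k ζ(k, 1 − a/q))`), `1 ≤ a < q/2`, `(a, q) = 1`, are linearly
independent over `ℚ`. [cite: GunRammurtyRath2011, Lemma 1 and eq. (2), p. 1332] -/
theorem okada_linearIndependent_hurwitzZeta.level_scaled
    (h : okada_linearIndependent_hurwitzZeta) {k q : ℕ} (hk : 2 ≤ k) (hq : 3 ≤ q) :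
    LinearIndependent ℚ fun a : {a : ℕ // 2 * a < q ∧ Nat.Coprime a q} =>
      (∑' n : ℕ, 1 / ((q : ℝ) * n + (a : ℕ)) ^ k) +
        (-1 : ℝ) ^ k * ∑' n : ℕ, 1 / ((q : ℝ) * n + ((q : ℝ) - (a : ℕ))) ^ k := by
  have hq0 : (q : ℝ) ≠ 0 := by exact_mod_cast (show q ≠ 0 by omega)
  have hqk : ((q : ℚ) ^ k) ≠ 0 := pow_ne_zero _ (by exact_mod_cast (show q ≠ 0 by omega))
  convert (h k q hk hq).units_smul (fun _ => Units.mk0 (((q : ℚ) ^ k)⁻¹) (inv_ne_zero hqk))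
    using 1
  funext a
  simp only [Pi.smul_apply', Units.smul_def, Units.val_mk0, Rat.smul_def, Rat.cast_inv,
    Rat.cast_pow, Rat.cast_natCast]
  simp_rw [one_div_natCast_add_div_pow _ k hq0, one_div_natCast_add_one_sub_div_pow _ k hq0,
    tsum_mul_left]
  have hqk' : (q : ℝ) ^ k ≠ 0 := pow_ne_zero _ hq0
  field_simp

/-- Summability of the shifted `p`-series `Σ_{n ≥ 0} 1/(n + x)^k` for `k ≥ 2`, `0 ≤ x`.
[folklore] -/
theorem summable_one_div_natCast_add_pow {x : ℝ} (hx : 0 ≤ x) {k : ℕ} (hk : 2 ≤ k) :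
    Summable fun n : ℕ => 1 / ((n : ℝ) + x) ^ k := by
  have hk' : (1 : ℝ) < k := by exact_mod_cast hk
  refine ((Real.summable_one_div_nat_add_rpow x k).2 hk').congr fun n => ?_
  rw [abs_of_nonneg (by positivity), Real.rpow_natCast]

/-- `Σ_{n ∈ ℤ} 1/(n + x)^k = ζ(k, x) + (−1)^k ζ(k, 1 − x)` for `0 ≤ x ≤ 1`, `k ≥ 2`
(split the two-sided sum at `0`; the term with `n = −(m+1)` is `(−1)^k/(m + (1 − x))^k`).
[folklore] -/
theorem tsum_int_one_div_add_pow {x : ℝ} (hx0 : 0 ≤ x) (hx1 : x ≤ 1) {k : ℕ} (hk : 2 ≤ k) :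
    ∑' n : ℤ, 1 / ((n : ℝ) + x) ^ k =
      (∑' n : ℕ, 1 / ((n : ℝ) + x) ^ k) +
        (-1 : ℝ) ^ k * ∑' n : ℕ, 1 / ((n : ℝ) + (1 - x)) ^ k := by
  have h1 : HasSum (fun n : ℕ => 1 / (((n : ℤ) : ℝ) + x) ^ k)
      (∑' n : ℕ, 1 / ((n : ℝ) + x) ^ k) := by
    simp_rw [Int.cast_natCast]
    exact (summable_one_div_natCast_add_pow hx0 hk).hasSum
  have hx' : 0 ≤ 1 - x := sub_nonneg.2 hx1
  have hfun : (fun n : ℕ => 1 / (((-((n : ℤ) + 1) : ℤ) : ℝ) + x) ^ k) =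
      fun n : ℕ => (-1 : ℝ) ^ k * (1 / ((n : ℝ) + (1 - x)) ^ k) := by
    funext n
    have h3 : (((-((n : ℤ) + 1) : ℤ) : ℝ) + x) = -((n : ℝ) + (1 - x)) := by push_cast; ring
    rw [h3, neg_pow, one_div, mul_inv, one_div]
    congr 1
    rcases neg_one_pow_eq_or ℝ k with h | h <;> simp [h]
  have h2 : HasSum (fun n : ℕ => 1 / (((-((n : ℤ) + 1) : ℤ) : ℝ) + x) ^ k)
      ((-1 : ℝ) ^ k * ∑' n : ℕ, 1 / ((n : ℝ) + (1 - x)) ^ k) := by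
    rw [hfun]
    exact (summable_one_div_natCast_add_pow hx' hk).hasSum.mul_left ((-1 : ℝ) ^ k)
  exact (HasSum.of_nat_of_neg_add_one (f := fun n : ℤ => 1 / ((n : ℝ) + x) ^ k) h1 h2).tsum_eq

/-- **Two-sided form** (PROVED from the fact). For `k ≥ 2`, `q ≥ 3` the real numbers
`Σ_{n ∈ ℤ} 1/(n + a/q)^k` (`= ζ(k, a/q) + (−1)^k ζ(k, 1 − a/q)`), `1 ≤ a < q/2`, `(a, q) = 1`, are
linearly independent over `ℚ`. [cite: GunRammurtyRath2011, Lemma 1 and eq. (2), p. 1332] -/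
theorem okada_linearIndependent_hurwitzZeta.int_tsum
    (h : okada_linearIndependent_hurwitzZeta) {k q : ℕ} (hk : 2 ≤ k) (hq : 3 ≤ q) :
    LinearIndependent ℚ fun a : {a : ℕ // 2 * a < q ∧ Nat.Coprime a q} =>
      ∑' n : ℤ, 1 / ((n : ℝ) + (a : ℕ) / (q : ℝ)) ^ k := by
  convert h k q hk hq using 1
  funext a
  have ha : (a : ℕ) ≤ q := by have := a.2.1; omega
  exact tsum_int_one_div_add_pow (by positivity)
    (div_le_one_of_le₀ (by exact_mod_cast ha) (by positivity)) hk

end Literature.NumberTheory.Transcendental
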